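import Literature.MathematicalPhysics.QuantumManyBody.OneCoordinateMarginal
import Literature.Analysis.FunctionSpaces.L1CauchyModulusLimit
import Literature.Analysis.FunctionSpaces.VirialIdentityLimit
import HarnessLib

/-!
# Limits of one-coordinate slice data along a sequence of trial states

(namespace `Literature.MathematicalPhysics.QuantumManyBody.BoseGas`)

Packaging of `Literature.Analysis.FunctionSpaces.exists_sliceData_limits`,
`virialIdentity_of_limit` and `sliceBound_of_limit` for the one-coordinate slice data of a sequence
of bosonic trial states `Ψₖ` in the box `Λ_L^{n+1}` (particle `0`, direction `a`, wall coordinate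
`s = L - x_{0,a}`): mass `Mₖ(s) = marginalMassReal Ψₖ (0,a) (L-s)`, momentum
`Pₖ(s) = -2 sliceCurrent Ψₖ (0,a) (L-s)`, normal slice energy `ETₖ`, full slice energy `Eₖ`.
If the data are `L¹(0,L)`-Cauchy with a modulus, satisfy the finite-`k` relations (continuity,
`Mₖ = ∫₀ Pₖ`, Cauchy–Schwarz, `ETₖ ≤ Eₖ` a.e.), an approximate virial identity with error
`√δₖ (Ē + 2D²) + δₖ → 0` and the slice bound, then limit data `(m, p, et, e)` exist with the exact
virial identity, the slice bound, the a.e. relations, `∫₀ᵇ Mₖ → ∫₀ᵇ m` and `Eₖ → e` in `L¹(0,L)`.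

[folklore: direct method of the calculus of variations, one-dimensional bookkeeping]
-/

noncomputable section

namespace Literature.MathematicalPhysics.QuantumManyBody.BoseGas

open _root_.MeasureTheory Filter Set Function intervalIntegral
open scoped ENNReal NNReal Topology
open Literature.Analysis.FunctionSpaces

variable {N : ℕ}

/-- Change of variables `s = L - t` for `L¹` distances on `(0, L]`. [folklore] -/
theorem setIntegral_Ioc_abs_comp_sub_left {L : ℝ} (hL : 0 ≤ L) (F : ℝ → ℝ) :
    ∫ s in Ioc 0 L, |F (L - s)| = ∫ t in (0:ℝ)..L, |F t| := by
  rw [← intervalIntegral.integral_of_le hL,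
    intervalIntegral.integral_comp_sub_left (fun t => |F t|) L]
  simp

/-- **Limits of the one-coordinate slice data along a sequence of trial states** (see the module
docstring). [folklore] -/
theorem exists_sliceLimit_of_sequence {v : ℝ → ℝ≥0∞} {n : ℕ} {L : ℝ} (hL : 0 < L)
    (Ψ : ℕ → TrialState (n + 1) L) (a : Fin 3) (E' E₁ Ebar : ℝ) (ε δ β : ℕ → ℝ)
    (hε : Tendsto ε atTop (𝓝 E')) (hδ : Tendsto δ atTop (𝓝 0)) (hβ : Tendsto β atTop (𝓝 0))
    (hMc : ∀ k, Continuous fun s : ℝ => marginalMassReal (Ψ k).ψ ((0 : Fin (n + 1)), a) (L - s))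
    (hMnn : ∀ k (s : ℝ), 0 ≤ marginalMassReal (Ψ k).ψ ((0 : Fin (n + 1)), a) (L - s))
    (hPi : ∀ k, Integrable fun s : ℝ => sliceCurrent (Ψ k).ψ ((0 : Fin (n + 1)), a) (L - s))
    (hETi : ∀ k, Integrable fun s : ℝ => normalSliceEnergyReal (Ψ k).ψ ((0 : Fin (n + 1)), a) (L - s))
    (hEi : ∀ k, Integrable fun s : ℝ => sliceEnergyReal v (Ψ k).ψ ((0 : Fin (n + 1)), a) (L - s))
    (hFTC : ∀ k (s : ℝ), marginalMassReal (Ψ k).ψ ((0 : Fin (n + 1)), a) (L - s) =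
      ∫ x in (0 : ℝ)..s, -2 * sliceCurrent (Ψ k).ψ ((0 : Fin (n + 1)), a) (L - x))
    (hCS : ∀ k (s : ℝ), 0 ≤ normalSliceEnergyReal (Ψ k).ψ ((0 : Fin (n + 1)), a) (L - s) ∧
      (-2 * sliceCurrent (Ψ k).ψ ((0 : Fin (n + 1)), a) (L - s)) ^ 2 ≤
        4 * marginalMassReal (Ψ k).ψ ((0 : Fin (n + 1)), a) (L - s) *
          normalSliceEnergyReal (Ψ k).ψ ((0 : Fin (n + 1)), a) (L - s))
    (hETE : ∀ k, ∀ᵐ s : ℝ, normalSliceEnergyReal (Ψ k).ψ ((0 : Fin (n + 1)), a) (L - s) ≤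
      sliceEnergyReal v (Ψ k).ψ ((0 : Fin (n + 1)), a) (L - s))
    (hvir : ∀ k, ∀ g : ℝ → ℝ, ContDiff ℝ 1 g → (∀ s, |g s| ≤ 1) → ∀ D : ℝ, 0 ≤ D →
      (∀ s, |deriv g s| ≤ D) →
      |(∫ s in (0 : ℝ)..L, g s * sliceEnergyReal v (Ψ k).ψ ((0 : Fin (n + 1)), a) (L - s)) +
          (1 / 2) * (∫ s in (0 : ℝ)..L,
            deriv g s * (-2 * sliceCurrent (Ψ k).ψ ((0 : Fin (n + 1)), a) (L - s))) -
          ε k * ∫ s in (0 : ℝ)..L, g s * marginalMassReal (Ψ k).ψ ((0 : Fin (n + 1)), a) (L - s)| ≤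
        Real.sqrt (δ k) * (Ebar + 2 * D ^ 2) + δ k)
    (hsb : ∀ k, ∀ g : ℝ → ℝ, ContDiff ℝ 1 g → (∀ s, 0 ≤ g s) → (∀ s, g s ≤ 1) →
      (∫ s in (0 : ℝ)..L, g s * normalSliceEnergyReal (Ψ k).ψ ((0 : Fin (n + 1)), a) (L - s)) +
          E₁ * (∫ s in (0 : ℝ)..L, g s * marginalMassReal (Ψ k).ψ ((0 : Fin (n + 1)), a) (L - s)) ≤
        ∫ s in (0 : ℝ)..L, g s * sliceEnergyReal v (Ψ k).ψ ((0 : Fin (n + 1)), a) (L - s))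
    (hcP : ∀ k l, ∫ s in Ioc 0 L, |(-2 * sliceCurrent (Ψ k).ψ ((0 : Fin (n + 1)), a) (L - s)) -
      (-2 * sliceCurrent (Ψ l).ψ ((0 : Fin (n + 1)), a) (L - s))| ≤ β k + β l)
    (hcET : ∀ k l, ∫ s in Ioc 0 L, |normalSliceEnergyReal (Ψ k).ψ ((0 : Fin (n + 1)), a) (L - s) -
      normalSliceEnergyReal (Ψ l).ψ ((0 : Fin (n + 1)), a) (L - s)| ≤ β k + β l)
    (hcE : ∀ k l, ∫ s in Ioc 0 L, |sliceEnergyReal v (Ψ k).ψ ((0 : Fin (n + 1)), a) (L - s) -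
      sliceEnergyReal v (Ψ l).ψ ((0 : Fin (n + 1)), a) (L - s)| ≤ β k + β l) :
    ∃ (m p et e : ℝ → ℝ),
      ContinuousOn m (Icc 0 L) ∧ m 0 = 0 ∧ (∀ s ∈ Icc 0 L, 0 ≤ m s) ∧
      IntegrableOn p (Icc 0 L) ∧ IntegrableOn et (Icc 0 L) ∧ IntegrableOn e (Icc 0 L) ∧
      (∀ s ∈ Icc 0 L, m s = ∫ x in (0 : ℝ)..s, p x) ∧
      (∀ᵐ s ∂(volume.restrict (Icc 0 L)), 0 ≤ et s ∧ et s ≤ e s ∧ p s ^ 2 ≤ 4 * m s * et s) ∧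
      (∀ g : ℝ → ℝ, ContDiff ℝ 1 g →
        (∫ s in (0 : ℝ)..L, g s * e s) + (1 / 2) * (∫ s in (0 : ℝ)..L, deriv g s * p s) =
          E' * ∫ s in (0 : ℝ)..L, g s * m s) ∧
      (∀ g : ℝ → ℝ, ContDiff ℝ 1 g → (∀ s, 0 ≤ g s) →
        (∫ s in (0 : ℝ)..L, g s * et s) + E₁ * (∫ s in (0 : ℝ)..L, g s * m s) ≤
          ∫ s in (0 : ℝ)..L, g s * e s) ∧
      (∀ b ∈ Icc 0 L, Tendsto (fun k => ∫ s in (0 : ℝ)..b,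
          marginalMassReal (Ψ k).ψ ((0 : Fin (n + 1)), a) (L - s)) atTop (𝓝 (∫ s in (0 : ℝ)..b, m s))) ∧
      IntegrableOn e (Ioc 0 L) ∧
      (∀ k, IntegrableOn (fun s => sliceEnergyReal v (Ψ k).ψ ((0 : Fin (n + 1)), a) (L - s)) (Ioc 0 L)) ∧
      Tendsto (fun k => ∫ s in Ioc 0 L, |sliceEnergyReal v (Ψ k).ψ ((0 : Fin (n + 1)), a) (L - s) - e s|)
        atTop (𝓝 0) := by
  -- the four data sequences
  set M : ℕ → ℝ → ℝ := fun k s => marginalMassReal (Ψ k).ψ ((0 : Fin (n + 1)), a) (L - s) with hM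
  set P : ℕ → ℝ → ℝ := fun k s => -2 * sliceCurrent (Ψ k).ψ ((0 : Fin (n + 1)), a) (L - s) with hP
  set ET : ℕ → ℝ → ℝ := fun k s => normalSliceEnergyReal (Ψ k).ψ ((0 : Fin (n + 1)), a) (L - s) with hET
  set E : ℕ → ℝ → ℝ := fun k s => sliceEnergyReal v (Ψ k).ψ ((0 : Fin (n + 1)), a) (L - s) with hE
  have hPI : ∀ k, IntegrableOn (P k) (Ioc 0 L) := fun k => ((hPi k).const_mul (-2)).integrableOn
  have hETI : ∀ k, IntegrableOn (ET k) (Ioc 0 L) := fun k => (hETi k).integrableOn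
  have hEI : ∀ k, IntegrableOn (E k) (Ioc 0 L) := fun k => (hEi k).integrableOn
  have hMC : ∀ k, ContinuousOn (M k) (Icc 0 L) := fun k => (hMc k).continuousOn
  obtain ⟨m, p, et, e, hmc, hm0, hmnn, hpI, hetI, heI, hmp, hae, hPT, hETT, hEET, hMm⟩ :=
    exists_sliceData_limits hL.le M P ET E β hβ hPI hETI hEI (fun k s _ => hFTC k s)
      (fun k s _ => hMnn k s) (fun k s _ => hCS k s) (fun k => ae_restrict_of_ae (hETE k))
      hcP hcET hcE
  have hpO : IntegrableOn p (Ioc 0 L) := hpI.mono_set Ioc_subset_Icc_self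
  have hetO : IntegrableOn et (Ioc 0 L) := hetI.mono_set Ioc_subset_Icc_self
  have heO : IntegrableOn e (Ioc 0 L) := heI.mono_set Ioc_subset_Icc_self
  -- the virial identity in the limit
  set ω : ℝ → ℕ → ℝ := fun D k => Real.sqrt (δ k) * (Ebar + 2 * D ^ 2) + δ k with hω
  have hωT : ∀ D, Tendsto (ω D) atTop (𝓝 0) := fun D => by
    have h1 : Tendsto (fun k => Real.sqrt (δ k)) atTop (𝓝 0) := by
      have := (Real.continuous_sqrt.tendsto 0).comp hδ
      rwa [Real.sqrt_zero] at this
    simpa using (h1.mul_const (Ebar + 2 * D ^ 2)).add hδ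
  have hvir' := virialIdentity_of_limit hL.le M P E m p e ε E' ω hωT hε hPI hEI hpO heO hMC hmc
    hPT hEET (fun k => ∫ s in Ioc 0 L, |P k s - p s|) hPT hMm
    (fun g hg hg1 D hD hgD k => hvir k g hg hg1 D hD hgD)
  have hsb' := sliceBound_of_limit hL.le M ET E m et e E₁ hETI hEI hetO heO hMC hmc hETT hEET
    (fun k => ∫ s in Ioc 0 L, |P k s - p s|) hPT hMm (fun g hg hg0 hg1 k => hsb k g hg hg0 hg1)
  -- convergence of `∫₀ᵇ Mₖ`
  have hbT : ∀ b ∈ Icc 0 L, Tendsto (fun k => ∫ s in (0 : ℝ)..b, M k s) atTop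
      (𝓝 (∫ s in (0 : ℝ)..b, m s)) := by
    intro b hb
    have h := tendsto_setIntegral_mul_of_uniform hb.1 M m (fun k => (hMC k).mono (Icc_subset_Icc_right hb.2))
      (hmc.mono (Icc_subset_Icc_right hb.2)) (fun k => ∫ s in Ioc 0 L, |P k s - p s|) hPT
      (fun k s hs => hMm k s (Icc_subset_Icc_right hb.2 hs)) (w := fun _ : ℝ => (1 : ℝ))
      continuous_const (C := 1) (fun _ => by norm_num)
    simpa [intervalIntegral.integral_of_le hb.1] using h
  exact ⟨m, p, et, e, hmc, hm0, hmnn, hpI, hetI, heI, hmp, hae, hvir', hsb', hbT, heO, hEI, hEET⟩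

end Literature.MathematicalPhysics.QuantumManyBody.BoseGas

end
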